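import Summits.RiemannHypothesis.RiemannHypothesis.Theorems.HandoffDodgerExplicitWindow
import Summits.RiemannHypothesis.RiemannHypothesis.Theorems.HandoffDodgerSlabFourHorizon
import Summits.RiemannHypothesis.RiemannHypothesis.Theorems.HandoffDodgerSlabFourProfile
import Summits.RiemannHypothesis.RiemannHypothesis.Theorems.HandoffDodgerSlabFourWindow
import Summits.RiemannHypothesis.RiemannHypothesis.Theorems.HandoffDodgerSlabFourCost
import Summits.RiemannHypothesis.RiemannHypothesis.Theorems.HandoffDodgerSlabFourPhi
import Summits.RiemannHypothesis.RiemannHypothesis.Theorems.HandoffDodgerSmallCeiling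
import HarnessLib

/-!
# HANDOFF — FOURTH SLAB (6): THE RH-FREE ZERO-SUM CLAUSE ON `7100 ≤ q < 12500` BY SUB-SLABS (rh-explicit, W-P(P2) crux 19185, seat dodger-p2 gen0; DODGER-STAGE2-PLAN §2)

RH-FREE. HONEST FRAMING: nothing here bears on the truth of RH; every statement is an UPPER-clause ingredient (the zero-sum clause of
`SubwindowZeroSumFamily (1/5)`), RH is the LOWER clause `∀ q, 0 ≤ δ*(q)`, not touched.

The threshold-free theorem `HandoffDodgerExplicitWindow.dodger_witness_explicit_window` (gen10's explicit dodger witness with a free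
collar window, ATTEMPT-23 §7 (a)) is assembled on the FOURTH SLAB `7100 ≤ q < 12500` at the CONSTANT schedule `y = 28`, `N₁ = 36`,
`α = 12/25`, `n = q³`, `C = 1/5`, `b = L/2 − ε`, whose hypotheses hold there by parts (1)–(5) (`HandoffDodgerSlabFour{Horizon,Profile,
Window,Cost,Phi}`). Near the floor of the chain (≈ 7 000) the profile constant `κ` varies from `0.12` to `0.48` across the slab, so the
assembly is GENERIC in a sub-slab `[A, X]`: **`subwindowZeroSum_slabFour_of`** takes `A ≤ q ≤ X` and three rationals `(u₀, κ₀, B₂)` with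
purely NUMERIC side conditions (`73695 ≤ u₀·17.04(A−1)` ⇒ `η ≤ e^{u₀} − 1`; `κ₀ ≤ 2 − T₇(u₀) − 0.0394` with `T₇` the degree-7 Taylor
majorant of `exp`; `X ≤ 8103(1 + t + t²/2)`, `t = 2B₂ − 9` ⇒ `b ≤ B₂`; and the comparison `2490·B₂(B₂+1.17)·X < 0.0257·κ₀²·(1.506·10⁶)²`),
each discharged by `norm_num` in the five instances `[7100,7200)`, `[7200,7450)`, `[7450,8000)`, `[8000,9200)`, `[9200,12500)` (crude
margins 1.88, 2.31, 3.45, 5.76, 8.74; HOME/rh-explicit-dodger-p2/code/slab4_instances.py). Result: **`subwindowZeroSum_slabFour`** — the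
zero-sum clause for every pair of consecutive primes `q < q′` with `7100 ≤ q < 12500` (80 twins: the last 37 of the WEIL route's wall
`WallsSixtyKTwin` (stmt 19185) and 43 of `WallsTenKTwin` (19172)). The glue with gen13's family from `12500` and the upper clause
`upperClause_from_sevenThousandOneHundred` follow in `HandoffDodgerSlabFourFamily` once `HandoffDodgerSlabThreeCeiling` is in the tree.
No `sorry`, standard axioms; every ingredient is a theorem of this track or of Mathlib.

References: this track (ATTEMPT-16 THEOREMS 16.1–16.2, ATTEMPT-19 §7–§8, ATTEMPT-21 §1–§7, ATTEMPT-23 §1–§7; HOME/rh-explicit-dodger-p2/DODGER-STAGE2-PLAN.md §2).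
-/

set_option linter.dupNamespace false

noncomputable section

open Real Complex Set MeasureTheory Literature.NumberTheory.LFunctions Literature.NumberTheory.LFunctions.WeilContinuous

namespace Summit.RiemannHypothesis.RiemannHypothesis.Theorems.Handoff

open Summit.RiemannHypothesis.RiemannHypothesis.Theorems.MotivicDoor.SemilocalThreshold

/-- `e^{2b} ≥ q − 1` at the track's choice `b ∈ [L/2 − 2r, L/2 − r]`, `r = 1/(q³+1)` (`e^{2b} ≥ q·e^{−4r} ≥ q(1 − 4r) ≥ q − 1`).
[this track, ATTEMPT-23 §2] -/
theorem exp_two_b_ge_sub_one {q : ℕ} {L b r : ℝ} (hq : 2 ≤ q) (hL : L = Real.log q)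
    (hr : r = 1 / ((q : ℝ) ^ 3 + 1)) (hbq2 : L / 2 ≤ b + 2 * r) : (q : ℝ) - 1 ≤ Real.exp (2 * b) := by
  have hq0 : (0 : ℝ) < q := by exact_mod_cast (by omega : 0 < q)
  have hq1 : (1 : ℝ) ≤ q := by exact_mod_cast (by omega : 1 ≤ q)
  have hqL : (q : ℝ) = Real.exp L := by rw [hL, Real.exp_log hq0]
  have hr0 : 0 < r := by rw [hr]; positivity
  have hrq : r * (q : ℝ) ≤ 1 / 4 := by
    rw [hr, div_mul_eq_mul_div, one_mul, div_le_div_iff₀ (by positivity) (by norm_num)]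
    have hq2 : (2 : ℝ) ≤ q := by exact_mod_cast hq
    have hsq : (4 : ℝ) ≤ (q : ℝ) ^ 2 := by nlinarith
    nlinarith [hsq, hq0]
  have h1 : Real.exp (L - 4 * r) ≤ Real.exp (2 * b) := Real.exp_le_exp.2 (by linarith)
  have h2 : Real.exp (L - 4 * r) = q * Real.exp (-(4 * r)) := by rw [sub_eq_add_neg, Real.exp_add, hqL]
  have h3 : 1 - 4 * r ≤ Real.exp (-(4 * r)) := by have := Real.add_one_le_exp (-(4 * r)); linarith
  have h4 : (q : ℝ) * (1 - 4 * r) ≤ q * Real.exp (-(4 * r)) := mul_le_mul_of_nonneg_left h3 hq0.le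
  nlinarith

/-- `b ≤ B₂` from `e^{2b} ≤ X ≤ 8103·(1 + t + t²/2)`, `t = 2B₂ − 9 ≥ 0` (`e⁹ ≥ 8103`, `1 + t + t²/2 ≤ e^t`). [folklore] -/
theorem b_le_of_exp_le {b B₂ X : ℝ} (hX : Real.exp (2 * b) ≤ X) (hB₂ : 9 ≤ 2 * B₂)
    (hXB : X ≤ 8103 * (1 + (2 * B₂ - 9) + (2 * B₂ - 9) ^ 2 / 2)) : b ≤ B₂ := by
  have h9 : (8103 : ℝ) ≤ Real.exp 9 := by
    have h9e : Real.exp 1 ^ 9 = Real.exp 9 := by exact_mod_cast Real.exp_one_pow 9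
    have hgt := Real.exp_one_gt_d9
    have : (2.7182818283 : ℝ) ^ 9 ≤ Real.exp 1 ^ 9 := pow_le_pow_left₀ (by norm_num) hgt.le 9
    rw [← h9e]; exact le_trans (by norm_num) this
  set t := 2 * B₂ - 9 with ht
  have ht0 : 0 ≤ t := by linarith
  have hq : 1 + t + t ^ 2 / 2 ≤ Real.exp t := Real.quadratic_le_exp_of_nonneg ht0
  have hexp : Real.exp (2 * b) ≤ Real.exp (2 * B₂) := by
    have e : Real.exp (2 * B₂) = Real.exp 9 * Real.exp t := by rw [← Real.exp_add]; congr 1; rw [ht]; ring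
    rw [e]
    calc Real.exp (2 * b) ≤ X := hX
      _ ≤ 8103 * (1 + t + t ^ 2 / 2) := hXB
      _ ≤ Real.exp 9 * Real.exp t := mul_le_mul h9 hq (by positivity) (Real.exp_pos 9).le
  have := Real.exp_le_exp.1 hexp
  linarith

set_option maxHeartbeats 800000 in
/-- **THEOREM (the RH-free zero-sum clause on a SUB-SLAB `[A, X]` of the fourth slab, generic numeric side conditions).**
See the module docstring. [this track, ATTEMPT-16 THEOREM 16.2; ATTEMPT-23 §7; DODGER-STAGE2-PLAN §2] -/
theorem subwindowZeroSum_slabFour_of {q q' A X : ℕ} {u₀ κ₀ B₂ : ℝ} (hqq' : ConsecutivePrimes q q')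
    (hA : 7100 ≤ A) (hAq : A ≤ q) (hqX : q ≤ X) (hX : X ≤ 12499)
    (hu₀ : 73695 ≤ u₀ * (17.04 * ((A : ℝ) - 1))) (hu₀0 : 0 ≤ u₀) (hu₀1 : u₀ ≤ 1)
    (hκ₀0 : 0 ≤ κ₀)
    (hκ₀ : κ₀ ≤ 2 - (1 + u₀ + u₀ ^ 2 / 2 + u₀ ^ 3 / 6 + u₀ ^ 4 / 24 + u₀ ^ 5 / 120 + u₀ ^ 6 / 720 + u₀ ^ 7 / 4410)
      - 394 / 10000)
    (hB₂ : 9 ≤ 2 * B₂) (hXB : (X : ℝ) ≤ 8103 * (1 + (2 * B₂ - 9) + (2 * B₂ - 9) ^ 2 / 2))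
    (hval : 2490 * B₂ * (B₂ + 1.17) * X < 257 / 10000 * κ₀ ^ 2 * 1506000 ^ 2) :
    ∃ θ : ℝ → ℂ, ∃ δ B : ℝ, IsWeilTest θ ∧ tsupport θ ⊆ Icc (-(Real.log q / 2)) (Real.log q / 2) ∧ 0 ≤ δ ∧
      δ ≤ 1 / 5 * Real.log q ^ (3 / 2 : ℝ) * (q : ℝ) ^ (-(3 / 2 : ℝ)) ∧ Real.log q / 2 + δ ≤ Real.log q' / 2 ∧
      (∀ U : ℝ, ∑ᶠ ρ ∈ weilZeroIndex U,
          (riemannZetaZeroOrder ρ : ℝ) * ‖weilMellin (fun x ↦ θ (x - δ) - θ (x + δ)) ρ‖ ^ 2 ≤ B) ∧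
      B < 2 * Real.log q / Real.sqrt q * (weilConv θ (weilReflect θ) (Real.log q - 2 * δ)).re := by
  obtain ⟨hqprime, -, hqq, -⟩ := hqq'
  have hq2 : 2 ≤ q := hqprime.two_le
  have hq0 : (0 : ℝ) < q := by exact_mod_cast hqprime.pos
  have hq₀ : 7100 ≤ q := hA.trans hAq
  have hq₁ : q < 12500 := by omega
  -- the mollifier radius `r = 1/(q³+1)`, a generic `ε ∈ [r, 2r]`, the half-width `b = L/2 − ε`
  have hr : (bump (q ^ 3)).rOut = 1 / ((q : ℝ) ^ 3 + 1) := by rw [bump_rOut]; push_cast; ring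
  have hr0 : 0 < (bump (q ^ 3)).rOut := (bump (q ^ 3)).rOut_pos
  obtain ⟨ε, ⟨hε1, hε2⟩, hgen⟩ := exists_generic_shift (Real.log q) hr0
  set b : ℝ := Real.log q / 2 - ε with hb
  have hbq1 : b + (bump (q ^ 3)).rOut ≤ Real.log q / 2 := by linarith
  have hbq2 : Real.log q / 2 ≤ b + 2 * (bump (q ^ 3)).rOut := by linarith
  -- part (3), radius: `7099 ≤ e^{2b} ≤ 12499`, `2b ≤ L`, `q = e^L`
  obtain ⟨-, -, -, -, hqL, he, he', hL1, -, -⟩ := radius_facts_slabFour hq₀ hq₁ rfl hr hbq1 hbq2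
  obtain ⟨hb0, hb1'⟩ := slabFour_b_bounds he he'
  have hb1 : 1 ≤ b := by linarith
  -- the sub-slab data: `e^{2b} ≥ q − 1 ≥ A − 1`, `e^{2b} ≤ q ≤ X`, `b ≤ B₂`
  have heq1 : (q : ℝ) - 1 ≤ Real.exp (2 * b) := exp_two_b_ge_sub_one hq2 rfl hr hbq2
  have hAq' : (A : ℝ) ≤ q := by exact_mod_cast hAq
  have hX2 : Real.exp (2 * b) ≤ X := by
    have h1 : Real.exp (2 * b) ≤ Real.exp (Real.log q) := Real.exp_le_exp.2 hL1
    rw [← hqL] at h1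
    have h2 : (q : ℝ) ≤ X := by exact_mod_cast hqX
    linarith
  have hbB : b ≤ B₂ := b_le_of_exp_le hX2 hB₂ hXB
  -- part (1): the horizon
  obtain ⟨hside1, hside2⟩ := slabFour_horizon_side_conditions he he'
  obtain ⟨hA', hB', hT3, hk2, hℓ2, hK1, -⟩ := slabFour_horizon_index_bounds he he'
  obtain ⟨h101, hT'T₀, -, hTbig, -, hcI, -, hcI3, hcL, hpL, hpU0, hpU, hW1, -, hW3, hk2', hk04, hTe⟩ :=
    slabFour_horizon_sizes_B he he'
  have hTT₀ : π * (dodgerKprime b : ℝ) / b ≤ 2 * π * Real.exp (1 + 2 * b) := hT'T₀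
  have hT₀T : 2 * π * Real.exp (1 + 2 * b) ≤ 101 / 100 * (π * (dodgerKprime b : ℝ) / b) := h101
  have hp : 0 < dodgerPL b := lt_of_lt_of_le (by have := Real.pi_pos; positivity) hpL
  -- the horizon floor of the sub-slab: `Tm = 17.04(A−1) ≤ 17.04e^{2b} ≤ T′`
  set Tm : ℝ := 17.04 * ((A : ℝ) - 1) with hTm
  have hA7100 : (7100 : ℝ) ≤ A := by exact_mod_cast hA
  have hTm0 : 0 < Tm := by rw [hTm]; linarith
  have hTmT : Tm ≤ π * (dodgerKprime b : ℝ) / b := by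
    rw [hTm]
    have : 17.04 * ((A : ℝ) - 1) ≤ 17.04 * Real.exp (2 * b) := by nlinarith
    exact this.trans hTe
  -- part (3): the window conditions
  obtain ⟨-, ⟨hδU0, hδU1, hδb⟩, ⟨hr600, -⟩, hδC, hwin, ⟨hQ0, hQ⟩⟩ :=
    window_conditions_slabFour (T := π * (dodgerKprime b : ℝ) / b) (pL := dodgerPL b) (pU := dodgerPU b)
      (y := 28) hq₀ hq₁ rfl hr hbq1 hbq2 hTT₀ hT₀T hpL hpU0 hpU rfl rfl rfl
  -- part (2): the profile-control constants, `κ ≥ 2 − e^{u₀} − 0.0394 ≥ κ₀`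
  obtain ⟨hN, hρ11, hρ2e, hκ⟩ :=
    profile_constants_slabFour (T := π * (dodgerKprime b : ℝ) / b) (k := (dodgerKprime b : ℝ)) (pL := dodgerPL b) (W := dodgerW b)
      (y := 28) (N₁ := 36) hb1' hTbig hTm0 hTmT hW1 hW3 hk2' hk04 hpL rfl rfl rfl rfl rfl rfl rfl rfl rfl hu₀
  have hexp := exp_le_taylor_seven hu₀0 hu₀1
  have hκ₀κ : κ₀ ≤ 1 - (Real.exp (2 * (1 / dodgerPL b + (dodgerKprime b : ℝ) * (π * (dodgerKprime b : ℝ) / b + 1 / 2) /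
      dodgerPL b ^ 2) * dodgerW b * ((36 : ℕ) : ℝ) ^ 2) - 1) -
      3 * ((Real.exp (3 + (1 + (dodgerKprime b : ℝ) * (π * (dodgerKprime b : ℝ) / b + 1 / 2) / dodgerPL b)) * (4 * (28 : ℝ) ^ 2) /
        (4 * (((36 : ℕ) : ℝ) + 1) ^ 3)) ^ (36 + 1) /
        (1 - Real.exp (3 + (1 + (dodgerKprime b : ℝ) * (π * (dodgerKprime b : ℝ) / b + 1 / 2) / dodgerPL b)) * (4 * (28 : ℝ) ^ 2) /
          (4 * (((36 : ℕ) : ℝ) + 1) ^ 3))) -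
      Real.exp (dodgerPL b / dodgerW b * (1 + 1 / 2 * Real.log (8 * Real.exp 2 * dodgerW b ^ 3 * (28 : ℝ) ^ 2 / dodgerPL b ^ 3)) +
          (dodgerKprime b : ℝ) * (π * (dodgerKprime b : ℝ) / b + 1 / 2) / (2 * dodgerW b)) /
        (1 - 8 * Real.exp 2 * dodgerW b ^ 3 * (28 : ℝ) ^ 2 / dodgerPL b ^ 3) := by
    linarith
  -- part (5): the profile value
  have hΦge := dodgerPhi_slabFour_ge
  -- part (4): the comparison
  have hlt := cost_lt_gain_slabFour (cI := dodgerCI b) (r := (bump (q ^ 3)).rOut) (L := Real.log q) (Q := Real.sqrt q)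
    hb0 hb1' he hL1 hTe hTT₀ hk2' hk04 hcI hcI3 rfl rfl hδU0 hδU1 hQ0 hQ hκ₀0 hκ₀κ hr600 rfl rfl hpU0 hpU (by norm_num) hΦge hbB hX2 hval
  -- the genericity of the lattice
  have hgen' : ∀ ρ : ℂ, riemannZeta ρ = 0 → 0 < ρ.im →
      ∀ k ∈ Finset.range (zetaZeroCount (π * (dodgerKprime b : ℝ) / b)), dodgerNode ρ - latticeFreq b (k + 1) ≠ 0 := by
    intro ρ hζ hρ k _
    have h := hgen ρ hζ hρ.ne' k
    rw [sub_ne_zero]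
    simpa [dodgerNode, latticeFreq] using h
  -- the explicit dodger with the window `α = 12/25`
  exact dodger_witness_explicit_window (q := q) (q' := q') (b := b) (T₀ := dodgerT₀ b)
    (y := 28) (C := 1 / 5) (α := 12 / 25) (n := q ^ 3) (k' := dodgerKprime b)
    (N₁ := 36) (by norm_num) (by norm_num) hb1 rfl hside1 hside2 hA' hB' hT3 hk2 hℓ2 hK1 rfl rfl rfl rfl rfl rfl (by norm_num)
    rfl rfl rfl rfl rfl rfl rfl rfl rfl hcL hp hN hρ11 hρ2e (le_trans hκ₀0 hκ₀κ) hδb hr600 hδC (hwin q' (by omega)) hbq1 hbq2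
    hgen' hlt

/-- **THEOREM (the RH-free zero-sum clause at rate `(1/5)(log q)^{3/2}q^{−3/2}` on the FOURTH SLAB `7100 ≤ q < 12500`)** — five sub-slabs
of `subwindowZeroSum_slabFour_of`, every side condition by `norm_num`. [this track, ATTEMPT-16 THEOREM 16.2; ATTEMPT-23 §7; DODGER-STAGE2-PLAN §2] -/
theorem subwindowZeroSum_slabFour {q q' : ℕ} (hqq' : ConsecutivePrimes q q') (hq₀ : 7100 ≤ q) (hq₁ : q < 12500) :
    ∃ θ : ℝ → ℂ, ∃ δ B : ℝ, IsWeilTest θ ∧ tsupport θ ⊆ Icc (-(Real.log q / 2)) (Real.log q / 2) ∧ 0 ≤ δ ∧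
      δ ≤ 1 / 5 * Real.log q ^ (3 / 2 : ℝ) * (q : ℝ) ^ (-(3 / 2 : ℝ)) ∧ Real.log q / 2 + δ ≤ Real.log q' / 2 ∧
      (∀ U : ℝ, ∑ᶠ ρ ∈ weilZeroIndex U,
          (riemannZetaZeroOrder ρ : ℝ) * ‖weilMellin (fun x ↦ θ (x - δ) - θ (x + δ)) ρ‖ ^ 2 ≤ B) ∧
      B < 2 * Real.log q / Real.sqrt q * (weilConv θ (weilReflect θ) (Real.log q - 2 * δ)).re := by
  rcases Nat.lt_or_ge q 7200 with h1 | h1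
  · exact subwindowZeroSum_slabFour_of (A := 7100) (X := 7199) (u₀ := 30461 / 50000) (κ₀ := 76 / 625) (B₂ := 9 / 2) hqq'
      le_rfl hq₀ (by omega) (by norm_num) (by norm_num) (by norm_num) (by norm_num) (by norm_num) (by norm_num) (by norm_num)
      (by norm_num) (by norm_num)
  rcases Nat.lt_or_ge q 7450 with h2 | h2
  · exact subwindowZeroSum_slabFour_of (A := 7200) (X := 7449) (u₀ := 15019 / 25000) (κ₀ := 137 / 1000) (B₂ := 9 / 2) hqq'
      (by norm_num) h1 (by omega) (by norm_num) (by norm_num) (by norm_num) (by norm_num) (by norm_num) (by norm_num) (by norm_num)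
      (by norm_num) (by norm_num)
  rcases Nat.lt_or_ge q 8000 with h3 | h3
  · exact subwindowZeroSum_slabFour_of (A := 7450) (X := 7999) (u₀ := 2903 / 5000) (κ₀ := 867 / 5000) (B₂ := 9 / 2) hqq'
      (by norm_num) h2 (by omega) (by norm_num) (by norm_num) (by norm_num) (by norm_num) (by norm_num) (by norm_num) (by norm_num)
      (by norm_num) (by norm_num)
  rcases Nat.lt_or_ge q 9200 with h4 | h4
  · exact subwindowZeroSum_slabFour_of (A := 8000) (X := 9199) (u₀ := 13517 / 25000) (κ₀ := 1217 / 5000) (B₂ := 1141 / 250) hqq'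
      (by norm_num) h3 (by omega) (by norm_num) (by norm_num) (by norm_num) (by norm_num) (by norm_num) (by norm_num) (by norm_num)
      (by norm_num) (by norm_num)
  · exact subwindowZeroSum_slabFour_of (A := 9200) (X := 12499) (u₀ := 9403 / 20000) (κ₀ := 3603 / 10000) (B₂ := 2361 / 500) hqq'
      (by norm_num) h4 (by omega) (by norm_num) (by norm_num) (by norm_num) (by norm_num) (by norm_num) (by norm_num) (by norm_num)
      (by norm_num) (by norm_num)

end Summit.RiemannHypothesis.RiemannHypothesis.Theorems.Handoff

end
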